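import Summits.KontsevichZagierPeriods.KontsevichZagierPeriods.Theorems.RootDecompRelativeModAbsoluteRegFoldingDegOneP08

/-!
# `RegFoldingDegOne` (route `RootDecompRelativeModAbsolute`, support item stmt-KontsevichZagierPeriods-30571) — PROVED · part 9/14

Cell `decomp-kz`, lens 3 (decomp-kz-lens-3 g9): `regFoldingDegOne_holds :
Theses.RootDecompRelativeModAbsolute.RegFoldingDegOne` BY NAME (in part 14/14) — every Kontsevich–Zagier
integral representation on `ℝ²` whose integrand is a quotient `p/q` of `ℚ`-polynomials with `deg_t q ≤ 1`,
`q ≠ 0` on the domain, is equivalent in `KZ.relations` to `[g] + Σᵢ [Uᵢ]`, the `Uᵢ` honest 2-cells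
`[g.domain × (0,1), hᵢ(x) θ^{Mᵢ}/(1 + θ^{eᵢ} κᵢ(x))]` (unfolded REGULARISED log/arctan monomials), with the
fibre integrals matching a.e.  Architecture: §1–§2 regularised terms `RTerm`, `RegFolding d`; §7 a.e.-congruence;
§8 gluing (`FoldsTo`); §9 one-band toolkit; §P analytic core (kernel independence); §10 cylinders; §11 affine band
chart; §13 `RegFolding 1` from a CAD band cover a.e. + vanishing on unbounded bands; last part: the edge to the born
item text and `regFoldingDegOne_holds`.

Source: `HOME/decomp-kz-lens-3/g9/landing/RootDecompRelativeModAbsoluteRegFoldingDegOne.lean` sha256 60038aa44a5f6303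
(4275 l; critic decomp-kz-crit-1 g2 CLEARED/kernel-confirmed 2026-08-30T09:41:19Z, std axioms), split mechanically
into 14 modules ≤ 400 lines by the landing seat decomp-kz-census-1 g7 (contexts re-opened per part; generic docstrings
added where the source had none; parts 1–13 do not import the route file).  No `sorry`; standard axioms.
References: [cite: KontsevichZagier2001, §1.2]; Basu–Pollack–Roy 2006 Def. 5.1 / Cor. 5.7; Bochnak–Coste–Roy 1998 §2.9.
-/

noncomputable section

open Set MeasureTheory Filter Topology
open scoped BigOperators
open Literature.NumberTheory.Transcendental Literature.ModelTheory.ExponentialFields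

namespace Summit.KontsevichZagierPeriods.RootDecompRelativeModAbsolute.Rung30571

namespace RegularisedLogLayer

namespace Plan

section Use

variable {α : Type*} [MeasurableSpace α] {μ : Measure α} {m : ℕ}

/-- Regimes A/C/D (`M = 0`, `|κ| ≥ η`): `aₖ ∈ L¹` and `b·ℓ₀(κ) ∈ L¹`. -/
theorem integrable_coeffs_away {η : ℝ} (hη : 0 < η) (a : α → Fin (m + 1) → ℝ) (b κ : α → ℝ)
    (ha : ∀ k, AEStronglyMeasurable (fun x => a x k) μ)
    (hbℓ : AEStronglyMeasurable (fun x => b x * ell0 (κ x)) μ)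
    (hκ : ∀ x, -1 < κ x ∧ η ≤ |κ x|)
    (hA : Integrable (fun x => ∫ θ in Ioo (0 : ℝ) 1,
      |∑ k : Fin (m + 1), a x k * θ ^ (k : ℕ) + b x / (1 + κ x * θ)|) μ) :
    (∀ k, Integrable (fun x => a x k) μ) ∧ Integrable (fun x => b x * ell0 (κ x)) μ := by
  obtain ⟨c, hc, h⟩ := kernelIndependenceAway m hη
  have key : ∀ x, c * (∑ k, |a x k| + |b x| * ell0 (κ x)) ≤
      ∫ θ in Ioo (0 : ℝ) 1, |∑ k : Fin (m + 1), a x k * θ ^ (k : ℕ) + b x / (1 + κ x * θ)| :=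
    fun x => h (κ x) (hκ x).1 (hκ x).2 (a x) (b x)
  have hsum : ∀ x k, |a x k| ≤ ∑ j, |a x j| := fun x k =>
    Finset.single_le_sum (f := fun j => |a x j|) (fun j _ => abs_nonneg _) (Finset.mem_univ k)
  refine ⟨fun k => ?_, ?_⟩
  · refine Integrable.mono' (hA.div_const c) (ha k) (Eventually.of_forall fun x => ?_)
    rw [Real.norm_eq_abs, le_div_iff₀ hc]
    have h1 := key x
    have h2 := hsum x k
    have h3 : 0 ≤ |b x| * ell0 (κ x) := mul_nonneg (abs_nonneg _) (ell0_nonneg (hκ x).1)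
    nlinarith
  · refine Integrable.mono' (hA.div_const c) hbℓ (Eventually.of_forall fun x => ?_)
    rw [Real.norm_eq_abs, le_div_iff₀ hc, abs_mul, abs_of_nonneg (ell0_nonneg (hκ x).1)]
    have h1 := key x
    have h3 : 0 ≤ ∑ j, |a x j| := Finset.sum_nonneg fun j _ => abs_nonneg _
    nlinarith

/-- Regime B (`M = m + 1`, `|κ| ≤ η₁`): `aₖ ∈ L¹` (`k ≤ m`) and `b ∈ L¹`. -/
theorem integrable_coeffs_taylor (a : α → Fin (m + 1) → ℝ) (b κ : α → ℝ)
    (ha : ∀ k, AEStronglyMeasurable (fun x => a x k) μ) (hb : AEStronglyMeasurable b μ)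
    {η₁ c : ℝ} (hc : 0 < c)
    (hT : ∀ κ' : ℝ, |κ'| ≤ η₁ → ∀ (a' : Fin (m + 1) → ℝ) (b' : ℝ), c * (∑ k, |a' k| + |b'|) ≤
      ∫ θ in Ioo (0 : ℝ) 1, |∑ k : Fin (m + 1), a' k * θ ^ (k : ℕ) + b' * θ ^ (m + 1) / (1 + κ' * θ)|)
    (hκ : ∀ x, |κ x| ≤ η₁)
    (hA : Integrable (fun x => ∫ θ in Ioo (0 : ℝ) 1,
      |∑ k : Fin (m + 1), a x k * θ ^ (k : ℕ) + b x * θ ^ (m + 1) / (1 + κ x * θ)|) μ) :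
    (∀ k, Integrable (fun x => a x k) μ) ∧ Integrable b μ := by
  have key : ∀ x, c * (∑ k, |a x k| + |b x|) ≤
      ∫ θ in Ioo (0 : ℝ) 1, |∑ k : Fin (m + 1), a x k * θ ^ (k : ℕ) + b x * θ ^ (m + 1) / (1 + κ x * θ)| :=
    fun x => hT (κ x) (hκ x) (a x) (b x)
  have hsum : ∀ x k, |a x k| ≤ ∑ j, |a x j| := fun x k =>
    Finset.single_le_sum (f := fun j => |a x j|) (fun j _ => abs_nonneg _) (Finset.mem_univ k)
  refine ⟨fun k => ?_, ?_⟩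
  · refine Integrable.mono' (hA.div_const c) (ha k) (Eventually.of_forall fun x => ?_)
    rw [Real.norm_eq_abs, le_div_iff₀ hc]
    have h1 := key x
    have h2 := hsum x k
    nlinarith [abs_nonneg (b x)]
  · refine Integrable.mono' (hA.div_const c) hb (Eventually.of_forall fun x => ?_)
    rw [Real.norm_eq_abs, le_div_iff₀ hc]
    have h1 := key x
    have h3 : 0 ≤ ∑ j, |a x j| := Finset.sum_nonneg fun j _ => abs_nonneg _
    nlinarith

/-- Regime B packaged with the proved lemma: the constants come from `kernelIndependenceTaylor m`. -/
theorem integrable_coeffs_taylor' (a : α → Fin (m + 1) → ℝ) (b κ : α → ℝ)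
    (ha : ∀ k, AEStronglyMeasurable (fun x => a x k) μ) (hb : AEStronglyMeasurable b μ) :
    ∃ η₁ : ℝ, 0 < η₁ ∧ ((∀ x, |κ x| ≤ η₁) →
      Integrable (fun x => ∫ θ in Ioo (0 : ℝ) 1,
        |∑ k : Fin (m + 1), a x k * θ ^ (k : ℕ) + b x * θ ^ (m + 1) / (1 + κ x * θ)|) μ →
      (∀ k, Integrable (fun x => a x k) μ) ∧ Integrable b μ) := by
  obtain ⟨η₁, hη₁, c, hc, hT⟩ := kernelIndependenceTaylor m
  exact ⟨η₁, hη₁, fun hκ hA => integrable_coeffs_taylor a b κ ha hb hc hT hκ hA⟩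

end Use

end Plan

/-! ## §10 (g9, NEW) Folding `t`-degree-`≤ 1` rational integrands over a cylinder — PROVED

The content of NODE-g8 §3quinquies steps 3–6 for ONE cylinder `G × (0,1)` (after the chart): a
representation `r` on `cyl G` with integrand `N(x,θ)/(A(x) + B(x)θ)`, `N = Σ_{i≤n} cᵢ(x)θⁱ`, all of
`cᵢ, A, B` `ℚ`-semialgebraic on `G` and `A + Bθ ≠ 0` on the cylinder, FOLDS (`foldsTo_cyl_ratDegOne`).
Route: split `G` into the `ℚ`-semialgebraic pieces
* `A = 0` (pole ON the section `θ = 0`): the residue `c₀/B` vanishes a.e. (`1/θ ∉ L¹`), the rest is a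
  polynomial in `θ` (`foldsTo_cyl_polynomial`);
* `A ≠ 0, A + B = 0` (pole ON `θ = 1`): Horner division by `1 − θ`, residue `N(x,1)/A = 0` a.e.;
* `A ≠ 0, A + B ≠ 0` (then `κ = B/A > −1`), cut at a rational `0 < q < η₁(n)`:
  `|κ| < q` — TAYLOR division `N/(1+κθ) = Σ sₖθ^k + R θ^{n+1}/(1+κθ)` (order `M = n+1`, no division by
  `κ`), termwise integrability from `Plan.kernelIndependenceTaylor`;
  `|κ| ≥ q` — HORNER division `N/(1+κθ) = Σ wⱼθ^j + N(−1/κ)/(1+κθ)` (order `M = 0`), termwise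
  integrability from `Plan.kernelIndependenceAway q`;
  both then fold by `foldsTo_cyl_poly_add_single`; the pieces are glued by `foldsTo_of_base_split`. -/

section DegOneBands

variable {b : ℕ}

/-! ### §10.1 Fibre tools, non-integrable kernels, `Finset.range` wrappers, base splitting -/

/-- A.e. in the base ⇒ a.e. on the cylinder (a cylinder over a null set is null). [folklore] -/
theorem ae_cyl_of_ae_base {G : Set (Fin b → ℝ)} {p : (Fin b → ℝ) → Prop}
    (h : ∀ᵐ x : (Fin b → ℝ), x ∈ G → p x) :
    ∀ᵐ z : (Fin (b + 1) → ℝ), z ∈ RTerm.cyl G → p (Fin.init z) := by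
  have hN : volume {x : Fin b → ℝ | x ∈ G ∧ ¬ p x} = 0 := by
    have h' := ae_iff.1 h
    simpa only [Classical.not_imp] using h'
  have h1 := KZ.volume_setOf_init_mem_eq_zero (n := b) hN
  filter_upwards [measure_eq_zero_iff_ae_notMem.1 h1] with z hz hzG
  by_contra hp
  exact hz ⟨hzG.1, hp⟩

/-- Integrable on the cylinder ⇒ for a.e. base point the fibre function is integrable on `(0,1)`.
[folklore] -/
theorem ae_integrableOn_fibre {G : Set (Fin b → ℝ)} (hG : IsSemialgebraic ℚ G)
    {F : (Fin (b + 1) → ℝ) → ℝ} (hF : IntegrableOn F (RTerm.cyl G)) :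
    ∀ᵐ x : (Fin b → ℝ), x ∈ G → IntegrableOn (fun t : ℝ => F (Fin.snoc x t)) (Ioo (0 : ℝ) 1) := by
  have hcm : MeasurableSet (RTerm.cyl G) := (RTerm.isSemialgebraic_cyl hG).measurableSet_holds
  have hI : Integrable ((RTerm.cyl G).indicator F) := (integrable_indicator_iff hcm).2 hF
  filter_upwards [ae_integrable_snoc hI] with x hx hxG
  have hind : (fun t : ℝ => (RTerm.cyl G).indicator F (Fin.snoc x t)) =
      (Ioo (0 : ℝ) 1).indicator fun t => F (Fin.snoc x t) := by
    funext t
    by_cases ht : t ∈ Ioo (0 : ℝ) 1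
    · have hmem : (Fin.snoc x t : Fin (b + 1) → ℝ) ∈ RTerm.cyl G :=
        ⟨by simpa using hxG, by simpa using ht⟩
      rw [indicator_of_mem hmem, indicator_of_mem ht]
    · have hmem : (Fin.snoc x t : Fin (b + 1) → ℝ) ∉ RTerm.cyl G :=
        fun hz => ht (by simpa using hz.2)
      rw [indicator_of_notMem hmem, indicator_of_notMem ht]
  rw [hind, integrable_indicator_iff measurableSet_Ioo] at hx
  exact hx

/-- **The absolute fibre integrals are integrable on the base** (Fubini–Tonelli), in the form used
with the kernel-independence inequalities: over a measurable piece `P` of the base on which the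
fibre function is known. [folklore] -/
theorem integrableOn_fibre_abs (r : KZ.IntegralRep (b + 1)) {G : Set (Fin b → ℝ)}
    (hdom : r.domain = RTerm.cyl G) {P : Set (Fin b → ℝ)} (hPm : MeasurableSet P) (hPG : P ⊆ G)
    {F : (Fin b → ℝ) → ℝ → ℝ}
    (hF : ∀ x ∈ P, ∀ t ∈ Ioo (0 : ℝ) 1, r.integrand (Fin.snoc x t) = F x t) :
    IntegrableOn (fun x => ∫ t in Ioo (0 : ℝ) 1, |F x t|) P := by
  have hI : Integrable (r.domain.indicator r.integrand) :=
    (integrable_indicator_iff (KZ.IntegralRep.measurableSet_domain_holds r)).2 r.integrableOn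
  have h1 := (integrable_snoc_prod hI).integral_norm_prod_right
  refine (h1.integrableOn (s := P)).congr_fun (fun x hx => ?_) hPm
  have hxG : x ∈ G := hPG hx
  have hind : (fun t : ℝ => ‖r.domain.indicator r.integrand (Fin.snoc x t)‖) =
      (Ioo (0 : ℝ) 1).indicator fun t => |F x t| := by
    funext t
    by_cases ht : t ∈ Ioo (0 : ℝ) 1
    · have hmem : (Fin.snoc x t : Fin (b + 1) → ℝ) ∈ r.domain := by
        rw [hdom]; exact ⟨by simpa using hxG, by simpa using ht⟩
      rw [indicator_of_mem hmem, indicator_of_mem ht, Real.norm_eq_abs, hF x hx t ht]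
    · have hmem : (Fin.snoc x t : Fin (b + 1) → ℝ) ∉ r.domain := by
        rw [hdom]; exact fun hz => ht (by simpa using hz.2)
      rw [indicator_of_notMem hmem, indicator_of_notMem ht, norm_zero]
  show (∫ t : ℝ, ‖r.domain.indicator r.integrand (Fin.snoc x t)‖) = ∫ t in Ioo (0 : ℝ) 1, |F x t|
  rw [hind, integral_indicator measurableSet_Ioo]

/-- `1/θ ∉ L¹(0,1)`. [folklore] -/
private theorem not_integrableOn_inv_Ioo : ¬ IntegrableOn (fun t : ℝ => t⁻¹) (Ioo (0 : ℝ) 1) := by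
  intro h
  rcases (intervalIntegrable_inv_iff (a := (0 : ℝ)) (b := 1)).1
    ((intervalIntegrable_iff_integrableOn_Ioo_of_le zero_le_one).2 h) with h01 | hmem
  · exact zero_ne_one h01
  · exact hmem (by simp)

/-- `1/(1−θ) ∉ L¹(0,1)`. [folklore] -/
theorem not_integrableOn_inv_one_sub_Ioo :
    ¬ IntegrableOn (fun t : ℝ => (1 - t)⁻¹) (Ioo (0 : ℝ) 1) := by
  intro h
  have h' : IntegrableOn (fun t : ℝ => (t - 1)⁻¹) (Ioo (0 : ℝ) 1) := by
    refine h.neg.congr_fun (fun t _ => ?_) measurableSet_Ioo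
    show -(1 - t)⁻¹ = (t - 1)⁻¹
    rw [← inv_neg, neg_sub]
  rcases (intervalIntegrable_sub_inv_iff (a := (0 : ℝ)) (b := 1) (c := 1)).1
    ((intervalIntegrable_iff_integrableOn_Ioo_of_le zero_le_one).2 h') with h01 | hmem
  · exact zero_ne_one h01
  · exact hmem (by simp)

/-- **Pole residues vanish a.e.**: if on the cylinder over `P` the integrand of an (honest!) `r`
is fibrewise a polynomial in `θ` plus `e(x)·g(θ)` with `g ∉ L¹(0,1)`, then `e = 0` a.e. on `P`
(Fubini: a.e. fibre is integrable; the polynomial part always is). [folklore] -/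
theorem ae_eq_zero_of_pole (r : KZ.IntegralRep (b + 1)) {P : Set (Fin b → ℝ)}
    (hP : IsSemialgebraic ℚ P) (hdom : r.domain = RTerm.cyl P) (n : ℕ)
    (a : ℕ → (Fin b → ℝ) → ℝ) (e : (Fin b → ℝ) → ℝ) {g : ℝ → ℝ}
    (hg : ¬ IntegrableOn g (Ioo (0 : ℝ) 1))
    (hint : EqOn r.integrand (fun z =>
      (∑ k ∈ Finset.range n, a k (Fin.init z) * z (Fin.last b) ^ k) +
        e (Fin.init z) * g (z (Fin.last b))) r.domain) :
    ∀ᵐ x : (Fin b → ℝ), x ∈ P → e x = 0 := by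
  have hri : IntegrableOn r.integrand (RTerm.cyl P) := hdom ▸ r.integrableOn
  filter_upwards [ae_integrableOn_fibre hP hri] with x hx hxP
  have hfi := hx hxP
  by_contra he
  have hpoly : IntegrableOn (fun t : ℝ => ∑ k ∈ Finset.range n, a k x * t ^ k) (Ioo (0 : ℝ) 1) :=
    (continuous_finsetSum _ fun k _ => by fun_prop).integrableOn_Icc.mono_set Ioo_subset_Icc_self
  have heg : IntegrableOn (fun t : ℝ => e x * g t) (Ioo (0 : ℝ) 1) := by
    refine (hfi.sub hpoly).congr_fun (fun t ht => ?_) measurableSet_Ioo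
    have hmem : (Fin.snoc x t : Fin (b + 1) → ℝ) ∈ r.domain := by
      rw [hdom]; exact ⟨by simpa using hxP, by simpa using ht⟩
    rw [Pi.sub_apply, hint hmem]
    simp only [Fin.init_snoc, Fin.snoc_last]
    ring
  have hgint : IntegrableOn g (Ioo (0 : ℝ) 1) := by
    refine IntegrableOn.congr_fun (heg.const_mul (e x)⁻¹) (fun t _ => ?_) measurableSet_Ioo
    show (e x)⁻¹ * (e x * g t) = g t
    rw [← mul_assoc, inv_mul_cancel₀ he, one_mul]
  exact hg hgint

/-- Polynomial-in-`θ` integrands fold — `Finset.range` form (any number of coefficients, including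
none). [KZ 2001, §1.2 rule (3); folklore] -/
theorem foldsTo_cyl_polynomial_range (r : KZ.IntegralRep (b + 1)) {G : Set (Fin b → ℝ)}
    (hG : IsSemialgebraic ℚ G) (n : ℕ) {a : ℕ → (Fin b → ℝ) → ℝ}
    (ha : ∀ k, IsSemialgebraicFunOn ℚ G (a k)) (hdom : r.domain = RTerm.cyl G)
    (hint : EqOn r.integrand
      (fun z => ∑ k ∈ Finset.range n, a k (Fin.init z) * z (Fin.last b) ^ k) r.domain) :
    ∃ (T : RTerm b) (hT : T.Admissible), FoldsTo r T hT := by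
  cases n with
  | zero =>
    refine ⟨_, _, foldsTo_empty_of_integrand_zero fun z hz => ?_⟩
    rw [hint hz]
    simp
  | succ m =>
    obtain ⟨hT, h⟩ := foldsTo_cyl_polynomial r hG (m := m) (a := fun k => a k) (fun k => ha k)
      hdom (fun z hz => by
        rw [hint hz]
        dsimp only
        rw [← Fin.sum_univ_eq_sum_range])
    exact ⟨_, hT, h⟩

/-- `Finset.range` form of `foldsTo_cyl_poly_add_single` (integrability of the polynomial
coefficients is only needed for the indices that occur). -/
theorem foldsTo_cyl_poly_add_single_range (r : KZ.IntegralRep (b + 1)) {G : Set (Fin b → ℝ)}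
    (hG : IsSemialgebraic ℚ G) (n : ℕ) {a : ℕ → (Fin b → ℝ) → ℝ}
    (ha : ∀ k, IsSemialgebraicFunOn ℚ G (a k)) (hai : ∀ k < n, IntegrableOn (a k) G)
    {h κ : (Fin b → ℝ) → ℝ} (hh : IsSemialgebraicFunOn ℚ G h) (hκ : IsSemialgebraicFunOn ℚ G κ)
    {M e : ℕ} (he : e = 1 ∨ e = 2) (hκ1 : ∀ x ∈ G, -1 < κ x) (hdom : r.domain = RTerm.cyl G)
    (hint : EqOn r.integrand (fun z =>
      (∑ k ∈ Finset.range n, a k (Fin.init z) * z (Fin.last b) ^ k) +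
        h (Fin.init z) * kernel M e (κ (Fin.init z)) (z (Fin.last b))) r.domain) :
    ∃ (T : RTerm b) (hT : T.Admissible), FoldsTo r T hT := by
  cases n with
  | zero =>
    obtain ⟨hT, hf⟩ := foldsTo_cyl_monomial r hG hh hκ (M := M) he hκ1 hdom (fun z hz => by
      rw [hint hz]
      simp)
    exact ⟨_, hT, hf⟩
  | succ m =>
    obtain ⟨hT, hf⟩ := foldsTo_cyl_poly_add_single r hG (m := m) (a := fun k => a k)
      (fun k => ha k) (fun k => hai k k.2) hh hκ (M := M) he hκ1 hdom (fun z hz => by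
        rw [hint hz]
        dsimp only
        rw [← Fin.sum_univ_eq_sum_range])
    exact ⟨_, hT, hf⟩

/-- **Splitting the base in two.** `r` lives on `cyl G`, `G ⊆ P ∪ Q` with `P, Q ⊆ G` disjoint and
`ℚ`-semialgebraic; if the restrictions of `r` to `cyl P` and `cyl Q` fold, so does `r`
(domain additivity + null-set removal, `foldsTo_of_cover` with two pieces). -/
theorem foldsTo_of_base_split (r : KZ.IntegralRep (b + 1)) {G P Q : Set (Fin b → ℝ)}
    (hP : IsSemialgebraic ℚ P) (hQ : IsSemialgebraic ℚ Q) (hdom : r.domain = RTerm.cyl G)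
    (hPG : P ⊆ G) (hQG : Q ⊆ G) (hcov : G ⊆ P ∪ Q) (hPQ : Disjoint P Q)
    (h₁ : ∀ (hs : IsSemialgebraic ℚ (RTerm.cyl P)) (hsub : RTerm.cyl P ⊆ r.domain),
      ∃ (T : RTerm b) (hT : T.Admissible), FoldsTo (r.restrict (RTerm.cyl P) hs hsub) T hT)
    (h₂ : ∀ (hs : IsSemialgebraic ℚ (RTerm.cyl Q)) (hsub : RTerm.cyl Q ⊆ r.domain),
      ∃ (T : RTerm b) (hT : T.Admissible), FoldsTo (r.restrict (RTerm.cyl Q) hs hsub) T hT) :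
    ∃ (T : RTerm b) (hT : T.Admissible), FoldsTo r T hT := by
  have cyl_mono : ∀ {S S' : Set (Fin b → ℝ)}, S ⊆ S' → RTerm.cyl S ⊆ RTerm.cyl S' :=
    fun h z hz => ⟨h hz.1, hz.2⟩
  have hPs := RTerm.isSemialgebraic_cyl hP
  have hQs := RTerm.isSemialgebraic_cyl hQ
  have hPr : RTerm.cyl P ⊆ r.domain := by rw [hdom]; exact cyl_mono hPG
  have hQr : RTerm.cyl Q ⊆ r.domain := by rw [hdom]; exact cyl_mono hQG
  obtain ⟨T₁, hT₁, hf₁⟩ := h₁ hPs hPr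
  obtain ⟨T₂, hT₂, hf₂⟩ := h₂ hQs hQr
  have hWs : IsSemialgebraic ℚ (RTerm.cyl P ∪ RTerm.cyl Q) := hPs.union hQs
  have hWr : RTerm.cyl P ∪ RTerm.cyl Q ⊆ r.domain := union_subset hPr hQr
  have hnull : volume ((r.restrict _ hPs hPr).domain ∩ (r.restrict _ hQs hQr).domain) = 0 := by
    show volume (RTerm.cyl P ∩ RTerm.cyl Q) = 0
    have h0 : RTerm.cyl P ∩ RTerm.cyl Q = ∅ := by
      ext z
      simp only [mem_inter_iff, mem_empty_iff_false, iff_false, not_and]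
      exact fun hzP hzQ => Set.disjoint_left.1 hPQ hzP.1 hzQ.1
    rw [h0, measure_empty]
  have hW : FoldsTo (r.restrict _ hWs hWr) (T₁.glue T₂) (hT₁.glue hT₂) :=
    FoldsTo.glue (r := r.restrict _ hWs hWr) (r₁ := r.restrict _ hPs hPr)
      (r₂ := r.restrict _ hQs hQr) rfl hnull (fun _ _ => rfl) (fun _ _ => rfl) hf₁ hf₂
  have hsub : r.domain ⊆ RTerm.cyl P ∪ RTerm.cyl Q := by
    intro z hz
    rw [hdom] at hz
    rcases hcov hz.1 with h | h
    · exact Or.inl ⟨h, hz.2⟩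
    · exact Or.inr ⟨h, hz.2⟩
  refine ⟨_, _, FoldsTo.of_restrict hWs hWr ?_ hW⟩
  rw [Set.sdiff_eq_empty.2 hsub, measure_empty]

/-- Zero sets of `ℚ`-semialgebraic functions are `ℚ`-semialgebraic (graph elimination).
[BCR 1998, Prop. 2.2.6] -/
theorem isSemialgebraic_sep_eq_zero {s : Set (Fin b → ℝ)} {f : (Fin b → ℝ) → ℝ}
    (hf : IsSemialgebraicFunOn ℚ s f) : IsSemialgebraic ℚ {x | x ∈ s ∧ f x = 0} := by
  have hT : IsSemialgebraic ℚ {z : Fin (b + 1) → ℝ | z (Fin.last b) = 0} := by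
    simpa using isSemialgebraic_setOf_eval_eq_zero (k := ℚ) (R := ℝ)
      (MvPolynomial.X (Fin.last b) : MvPolynomial (Fin (b + 1)) ℚ)
  convert hf.isSemialgebraic_sep_snoc_mem tarski_seidenberg_real_holds hT using 1
  ext x
  simp

/-- Non-vanishing sets of `ℚ`-semialgebraic functions are `ℚ`-semialgebraic. [BCR 1998, Prop. 2.2.6] -/
theorem isSemialgebraic_sep_ne_zero {s : Set (Fin b → ℝ)} {f : (Fin b → ℝ) → ℝ}
    (hs : IsSemialgebraic ℚ s) (hf : IsSemialgebraicFunOn ℚ s f) :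
    IsSemialgebraic ℚ {x | x ∈ s ∧ f x ≠ 0} := by
  convert hs.diff (isSemialgebraic_sep_eq_zero hf) using 1
  ext x
  simp only [mem_setOf_eq, Set.mem_sdiff]
  tauto

/-- Strict sublevel comparisons of `ℚ`-semialgebraic functions are `ℚ`-semialgebraic.
[BCR 1998, Prop. 2.2.6] -/
theorem isSemialgebraic_sep_lt {s : Set (Fin b → ℝ)} {f g : (Fin b → ℝ) → ℝ}
    (hf : IsSemialgebraicFunOn ℚ s f) (hg : IsSemialgebraicFunOn ℚ s g) :
    IsSemialgebraic ℚ {x | x ∈ s ∧ f x < g x} := by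
  convert (IsSemialgebraicFunOn.sub_holds hf hg).isSemialgebraic_sep_neg using 1
  ext x
  simp [sub_neg]

/-- The negative of a `ℚ`-semialgebraic function. [BCR 1998, Prop. 2.2.6] -/
theorem isSemialgebraicFunOn_neg' {s : Set (Fin b → ℝ)} (hs : IsSemialgebraic ℚ s)
    {f : (Fin b → ℝ) → ℝ} (hf : IsSemialgebraicFunOn ℚ s f) :
    IsSemialgebraicFunOn ℚ s (fun x => -f x) := by
  have h0 : IsSemialgebraicFunOn ℚ s (fun _ => (0 : ℝ)) :=
    (isSemialgebraicFunOn_ratCast hs 0).congr fun x _ => by simp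
  exact (IsSemialgebraicFunOn.sub_holds h0 hf).congr fun x _ => by simp

end DegOneBands

section DegOneAlgebra

/-! ### §10.2 Division of `N(θ) = Σ_{i≤n} cᵢθⁱ` by `1 + κθ`: the Taylor and the Horner forms -/

end DegOneAlgebra

end RegularisedLogLayer

end Summit.KontsevichZagierPeriods.RootDecompRelativeModAbsolute.Rung30571

end
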